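import Literature.AnabelianGeometry.AbsoluteAnabelian.LocalUnramifiedValuation
import Literature.AnabelianGeometry.AbsoluteAnabelian.AbsAnabProp121viiUnramifiedInflation
import Literature.AnabelianGeometry.AbsoluteAnabelian.AbsAnabProp121viiInvariantMapProofs
import Literature.NumberTheory.GaloisRepresentations.ContinuousCohomologyNineTerm
import Literature.NumberTheory.GaloisRepresentations.GaloisCohomologyProofs
import HarnessLib

/-!
# Unramified units are cohomologically trivial: `H^q(Gal(F^nr/F), 𝒪^×_{F^nr}) = 0` (`q = 1, 2`),
# and the valuation isomorphism `H²(Gal(F^nr/F), (F^nr)ˣ) ⥲ H²(Gal(F^nr/F), ℤ) ⥲ ℚ/ℤ`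

For a non-archimedean local field `F` of characteristic `0`, `Q = Γ_F ⧸ I_F = Gal(F^nr/F)`, the
`Q`-modules `(F^nr)ˣ = (K̄ˣ)^{I_F}` and `U^nr = 𝒪^×_{F^nr}` and the valuation
`val : (F^nr)ˣ → ℤ` of `LocalUnramifiedValuation.lean`, this file proves:

* `subsingleton_one_unrUnitsRep` — **`H¹(Q, U^nr) = 0`** (long exact sequence of
  `0 → U^nr → (F^nr)ˣ → ℤ → 0`: `H¹(Q, (F^nr)ˣ) ↪ H¹(Γ_F, K̄ˣ) = 0` by inflation–restriction and
  Hilbert 90, and `δ₀ = 0` because every integer is the valuation of a `Q`-invariant, `ϖ^n`);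
* `cohomologyMap_unrValuationHom_two_injective`, `…_bijective` — **`H²(val) :
  H²(Q, (F^nr)ˣ) → H²(Q, ℤ)` is bijective**.  It is split surjective (uniformiser section); for
  injectivity we count torsion: `H²(Q, (F^nr)ˣ) ≅ H²(Γ_F, K̄ˣ) = Br(F)` by the unramified inflation
  (`Prop121vii.infUnramified_two_bijective`) is a torsion group whose `n`-torsion has at most `n`
  elements (it is covered by `H²(Γ_F, μ_n)`, of order `n`: Kummer theory,
  `Prop121vii.kummerTwoOntoTorsion_holds`, `Prop121vii.natCard_galoisCohomology_two_mu`), while the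
  `n`-torsion of `H²(Q, ℤ) ≅ ℚ/ℤ` (`H2UnrEquivQModZ`) has at least the `n` elements `k/n`; a split
  surjection of torsion groups with `#A[n] ≤ #B[n] < ∞` is injective
  (`AddMonoidHom.injective_of_splitting_of_card_torsion_le`);
* `subsingleton_two_unrUnitsRep` — **`H²(Q, U^nr) = 0`** (`H²(U^nr) → H²((F^nr)ˣ)` is injective since
  `H¹(Q, ℤ) = 0` (`subsingleton_one_trivial_ZCoeff`: `Q` compact, `ℤ` discrete torsion-free), and
  is zero since it lands in `ker H²(val) = 0`);
* `unrBrauerInvariant_bijective` — the composite **`H²(Gal(F^nr/F), (F^nr)ˣ) → H²(Gal(F^nr/F), ℤ)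
  ⥲ ℚ/ℤ`** (valuation, then the trunk's `H2UnrEquivQModZ` = «`H²(Ẑ, ℤ) = H¹(Ẑ, ℚ/ℤ) = ℚ/ℤ` by
  evaluation at Frobenius») is bijective.

This is print's step N3 of the proof of [AbsAnab] Prop 1.2.1 (vii) (p. 11 l.86 – p. 12 l.2,
«`H²(Gal(K^unr/K), (K^unr)ˣ) ⥲ H²(Gal(K^unr/K), ℤ) = H²(Ẑ, ℤ) = ℚ/ℤ` group-theoretic by (ii),
(iii), (iv)»), rows P32.i.L03 «units … cohomologically trivial» and P32.i.L04 «valuation» of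
[AbsTopIII] Prop 3.2 (i) (p. 71 l.36–57), and row L20 `ValuationIso` of [FrdII] Thm 2.4 (ii)
(p. 21 ll.16–22).  HONEST FRAMING: textbook local class field theory (Serre, *Local Fields* XII §3,
XIII §3), here obtained by a torsion count instead of the unit filtration; nothing here bears on
[IUTchIII] Cor. 3.12.

## References
* J.-P. Serre, *Local Fields*, GTM 67 (1979), XII §3 Lemma 3, XIII §3 Prop. 6–7. [SerreLocalFields1979]
* S. Mochizuki, *The absolute anabelian geometry of hyperbolic curves* (2004), Prop 1.2.1 (vii).
  [MochizukiAbsAnab2004]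
-/

noncomputable section

open CategoryTheory Function
open Field IsNonarchimedeanLocalField ValuativeRel IntermediateField

universe u

namespace Literature.AnabelianGeometry.AbsoluteAnabelian

open Literature.NumberTheory.GaloisRepresentations
open Literature.NumberTheory.GaloisRepresentations.IsNonarchimedeanLocalField
open Literature.NumberTheory.GaloisRepresentations.DiscreteGaloisModule
open Literature.NumberTheory.GaloisRepresentations.LocalWeilDatum
open _root_.TopRep _root_.ContRepresentation _root_.ContinuousCohomology _root_.Topology

/-! ### §1 A split surjection of torsion groups with small torsion is injective -/

/-- **A split surjection of torsion groups is injective once `#A[n] ≤ #B[n] < ∞`**: if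
`f : A → B` has a section `s` (`f ∘ s = id`), `A` is torsion, each `A[n]` is finite and
`#A[n] ≤ #B[n]`, then `s` maps `B[n]` ONTO `A[n]` (an injection between finite sets of the same size),
so an element of `ker f ∩ A[n]` is `s(b)` with `b = f(s b) = 0`. [cite: SerreLocalFields1979, XIII §3] -/
theorem _root_.AddMonoidHom.injective_of_splitting_of_card_torsion_le {A B : Type*} [AddCommGroup A]
    [AddCommGroup B] (f : A →+ B) (s : B →+ A) (hfs : ∀ b, f (s b) = b)
    (htors : ∀ a : A, ∃ n : ℕ, 0 < n ∧ n • a = 0)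
    (hfin : ∀ n : ℕ, 0 < n → Finite {a : A // n • a = 0})
    (hcard : ∀ n : ℕ, 0 < n → Nat.card {a : A // n • a = 0} ≤ Nat.card {b : B // n • b = 0}) :
    Injective f := by
  refine (injective_iff_map_eq_zero f).2 fun a ha => ?_
  obtain ⟨n, hn, hna⟩ := htors a
  haveI := hfin n hn
  let sn : {b : B // n • b = 0} → {a : A // n • a = 0} := fun b =>
    ⟨s b.1, by rw [← map_nsmul, b.2, map_zero]⟩
  have hsn : Injective sn := fun b b' h => Subtype.ext (by
    have h' : f (s b.1) = f (s b'.1) := congrArg (fun x : {a : A // n • a = 0} => f x.1) h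
    rwa [hfs, hfs] at h')
  obtain ⟨b, hb⟩ := (hsn.bijective_of_nat_card_le (hcard n hn)).2 ⟨a, hna⟩
  have hb' : s b.1 = a := congrArg Subtype.val hb
  have hb0 : b.1 = 0 := by rw [← hfs b.1, hb', ha]
  rw [← hb', hb0, map_zero]

/-! ### §2 `H¹(G, ℤ) = 0` for a compact group `G` acting trivially -/

/-- **`H¹(G, ℤ) = 0`** for a compact topological group `G` and the trivial discrete module `ℤ`:
`H¹` is torsion (`exists_nsmul_one_eq_zero`) and, the action being trivial, `H¹ = Hom_cont(G, ℤ)`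
(`oneCocycleClass_injective_of_trivial`) is torsion-free. [cite: SerreLocalFields1979, XIII §1] -/
theorem subsingleton_one_trivial_ZCoeff {G : Type u} [Group G] [TopologicalSpace G]
    [IsTopologicalGroup G] [CompactSpace G] :
    Subsingleton (continuousCohomology 1 (ContinuousRep.trivial G ℤ ZCoeff.{u}).toTopRep) := by
  refine ⟨fun x y => ?_⟩
  suffices h : ∀ z : continuousCohomology 1 (ContinuousRep.trivial G ℤ ZCoeff.{u}).toTopRep, z = 0 by
    rw [h x, h y]
  intro z
  obtain ⟨n, hn, hnz⟩ := exists_nsmul_one_eq_zero _ z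
  obtain ⟨φ, rfl⟩ := oneCocycleClass_surjective _ z
  have htriv : ∀ (g : G) (v : ZCoeff.{u}), (ContinuousRep.trivial G ℤ ZCoeff.{u}).toTopRep.ρ g v = v :=
    fun _ _ => rfl
  rw [← oneCocycleClassₗ_apply, ← map_nsmul, oneCocycleClassₗ_apply] at hnz
  have h0 : n • φ = 0 := oneCocycleClass_injective_of_trivial _ htriv (by rw [hnz, oneCocycleClass_zero])
  have hφ : φ = 0 := by
    refine Subtype.ext (ContinuousMap.ext fun g => ULift.ext _ _ ?_)
    have hg : n • φ.1 g = 0 := congrArg (fun ψ : contOneCocycles _ => ψ.1 g) h0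
    have hd : n • (φ.1 g).down = (0 : ℤ) := congrArg ULift.down hg
    exact (smul_eq_zero.1 hd).resolve_left hn.ne'
  rw [hφ, oneCocycleClass_zero]

/-! ### §3 The setting: `Q = Gal(F^nr/F)`, `(F^nr)ˣ`, `U^nr`, the valuation -/

variable (F : Type u) [Field F] [ValuativeRel F] [TopologicalSpace F] [IsNonarchimedeanLocalField F]
  [CharZero F]

/-- `H²(val) ∘ H²(sec) = id` on `H²(Gal(F^nr/F), ℤ)` (the uniformiser section splits the valuation on
cohomology). [cite: SerreLocalFields1979, XIII §3] -/
theorem cohomologyMap_unrValuationHom_section (n : ℕ)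
    (y : continuousCohomology n
      (ContinuousRep.trivial (absoluteGaloisGroup F ⧸ galUnr F) ℤ ZCoeff.{u}).toTopRep) :
    cohomologyMap (unrValuationHom F) n
        (cohomologyMap (unrUniformizerSection F (irreducible_unrUniformizer F)) n y) = y := by
  have hcomp := map_comp_apply_of (ContinuousMonoidHom.id _) (ContinuousMonoidHom.id _)
    (ContinuousMonoidHom.id _) (fun _ => rfl)
    (resIdHom (unrUniformizerSection F (irreducible_unrUniformizer F))) (resIdHom (unrValuationHom F))
    (resIdHom (unrUniformizerSection F (irreducible_unrUniformizer F) ≫ unrValuationHom F))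
    (fun _ => rfl) n y
  change _ = _ at hcomp
  rw [← show cohomologyMap (unrUniformizerSection F (irreducible_unrUniformizer F) ≫ unrValuationHom F) n y
      = cohomologyMap (unrValuationHom F) n
        (cohomologyMap (unrUniformizerSection F (irreducible_unrUniformizer F)) n y) from hcomp,
    unrUniformizerSection_comp_unrValuationHom]
  have hmap : cohomologyMap (𝟙 ((ContinuousRep.trivial (absoluteGaloisGroup F ⧸ galUnr F) ℤ
      ZCoeff.{u}).toTopRep)) n = 𝟙 _ :=
    ContinuousCohomology.map_id _ n
  rw [hmap]
  rfl

/-- **`H¹(Gal(F^nr/F), U^nr) = 0`**: by the long exact sequence of `0 → U^nr → (F^nr)ˣ → ℤ → 0`,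
`H¹(U^nr)` sits between `coker(H⁰((F^nr)ˣ) → H⁰(ℤ)) = 0` (every integer is the valuation of the
invariant `ϖ^n`) and `H¹(Gal(F^nr/F), (F^nr)ˣ) ↪ H¹(Γ_F, K̄ˣ) = 0` (inflation is injective in degree
one; Hilbert 90).  «The units of `K^unr` are cohomologically trivial», degree `1`.
[cite: SerreLocalFields1979, XII §3 Lemma 3] -/
theorem subsingleton_one_unrUnitsRep :
    Subsingleton (continuousCohomology 1 (unrUnitsRep F).toTopRep) := by
  have hS := isSES_unrUnits F
  refine ⟨fun x y => ?_⟩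
  suffices h : ∀ z : continuousCohomology 1 (unrUnitsRep F).toTopRep, z = 0 by rw [h x, h y]
  intro z
  -- `H¹(incl) z = 0`: `H¹(Q, (F^nr)ˣ)` injects into `H¹(Γ_F, K̄ˣ) = 0`
  have h90 : Subsingleton (continuousCohomology 1 (units F).toTopRep) :=
    subsingleton_galoisCohomology_units_one_holds F
  have hinf := inf_one_injective_discrete (galUnr F) (units F)
  have h1 : cohomologyMap (unrUnitsIncl F) 1 z = 0 := by
    apply hinf
    exact Subsingleton.elim _ _
  -- hence `z = δ₀ v`, and `δ₀ v = 0` since `v ∈ ℤ` lifts to the invariant `ϖ^v`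
  obtain ⟨v, rfl⟩ := hS.exists_δ₀_eq_of_map_one_eq_zero z h1
  rw [hS.δ₀_eq_zero_iff]
  refine ⟨(unrUniformizerSection F (irreducible_unrUniformizer F)).hom v.1, fun q => ?_, ?_⟩
  · -- invariance: the section is `Q`-equivariant and `Q` acts trivially on `ℤ`
    rw [ContinuousRep.toTopRep_ρ_apply,
      ← ContinuousRep.hom_comm_apply (unrUniformizerSection F (irreducible_unrUniformizer F)) q v.1]
    rfl
  · change (unrUniformizerSection F (irreducible_unrUniformizer F) ≫ unrValuationHom F).hom v.1 = v.1
    rw [unrUniformizerSection_comp_unrValuationHom]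
    rfl

/-- **`H²(val) : H²(Gal(F^nr/F), (F^nr)ˣ) → H²(Gal(F^nr/F), ℤ)` is injective** — torsion count: via
the unramified inflation `H²(Gal(F^nr/F), (F^nr)ˣ) ≅ H²(Γ_F, K̄ˣ)` (`Prop121vii.infUnramified_two_bijective`)
the `n`-torsion of the source has at most `n = #H²(Γ_F, μ_n)` elements (Kummer theory), the
`n`-torsion of `H²(Gal(F^nr/F), ℤ) ≅ ℚ/ℤ` has at least `n`, and `H²(val)` is split by the uniformiser
section; `AddMonoidHom.injective_of_splitting_of_card_torsion_le`.
[cite: SerreLocalFields1979, XIII §3 Prop. 6] -/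
theorem cohomologyMap_unrValuationHom_two_injective :
    Injective (cohomologyMap (unrValuationHom F) 2) := by
  classical
  haveI : CompactSpace (absoluteGaloisGroup F) := absoluteGaloisGroup_compactSpace F
  -- the two maps as additive homomorphisms
  let f : continuousCohomology 2 ((units F).quotientInvariants (galUnr F)).toTopRep →+
      continuousCohomology 2
        (ContinuousRep.trivial (absoluteGaloisGroup F ⧸ galUnr F) ℤ ZCoeff.{u}).toTopRep :=
    AddMonoidHom.mk' (fun a => cohomologyMap (unrValuationHom F) 2 a) (fun a a' => map_add _ a a')
  let s : continuousCohomology 2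
        (ContinuousRep.trivial (absoluteGaloisGroup F ⧸ galUnr F) ℤ ZCoeff.{u}).toTopRep →+
      continuousCohomology 2 ((units F).quotientInvariants (galUnr F)).toTopRep :=
    AddMonoidHom.mk'
      (fun b => cohomologyMap (unrUniformizerSection F (irreducible_unrUniformizer F)) 2 b)
      (fun b b' => map_add _ b b')
  have hfs : ∀ b, f (s b) = b := cohomologyMap_unrValuationHom_section F 2
  change Injective f
  -- torsion
  have htors : ∀ a : continuousCohomology 2 ((units F).quotientInvariants (galUnr F)).toTopRep,
      ∃ n : ℕ, 0 < n ∧ n • a = 0 := fun a => exists_nsmul_two_eq_zero _ a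
  -- `#A[n] ≤ n` through `Inf : A ≅ Br(F)` and Kummer theory
  have hA : ∀ n : ℕ, 0 < n →
      Finite {a : continuousCohomology 2 ((units F).quotientInvariants (galUnr F)).toTopRep //
          n • a = 0} ∧
        Nat.card {a : continuousCohomology 2 ((units F).quotientInvariants (galUnr F)).toTopRep //
          n • a = 0} ≤ n := by
    intro n hn
    haveI : NeZero n := ⟨hn.ne'⟩
    -- the unramified inflation, typed on the `DiscreteGaloisModule.quotientInvariants` form of `(F^nr)ˣ`
    -- used by `LocalUnramifiedValuation` (definitionally the `ContinuousRep.quotientInvariants` form)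
    let Inf : continuousCohomology 2 ((units F).quotientInvariants (galUnr F)).toTopRep →L[ℤ]
        continuousCohomology 2 (units F).toTopRep :=
      (ContinuousCohomology.map (ContinuousMonoidHom.quotientMk (galUnr F))
        (invariantsInclusion (galUnr F) (units F)) 2).hom
    have hInf : Injective Inf := (Prop121vii.infUnramified_two_bijective F).1
    obtain ⟨hκ, honto⟩ := Prop121vii.kummerTwoOntoTorsion_holds F n
    have hcardμ : Nat.card (continuousCohomology 2 (mu F n).toTopRep) = n :=
      Prop121vii.natCard_galoisCohomology_two_mu F n
    haveI : Finite (continuousCohomology 2 (mu F n).toTopRep) :=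
      Nat.finite_of_card_ne_zero (by rw [hcardμ]; exact hn.ne')
    -- every `n`-torsion class of `A` is, after inflation, the Kummer image of a class of `H²(μ_n)`
    have hex : ∀ a : {a : continuousCohomology 2 ((units F).quotientInvariants (galUnr F)).toTopRep //
        n • a = 0}, ∃ x : continuousCohomology 2 (mu F n).toTopRep,
        cohomologyMap (kummerι F n) 2 x = Inf a.1 := fun a => by
      refine honto _ ?_
      have h2 : Inf (n • a.1) = n • Inf a.1 := map_nsmul Inf n a.1
      rw [a.2, map_zero] at h2
      rw [natCast_zsmul, ← h2]
    choose g hg using hex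
    have hginj : Injective g := fun a a' h => Subtype.ext (hInf (by rw [← hg a, ← hg a', h]))
    exact ⟨Finite.of_injective g hginj,
      (Nat.card_le_card_of_injective g hginj).trans hcardμ.le⟩
  -- `n ≤ #B[n]`: the classes of invariant `k/n`, `k < n`, under `H²(Q, ℤ) ≅ ℚ/ℤ`
  have hB : ∀ n : ℕ, 0 < n →
      Finite {b : continuousCohomology 2 (ContinuousRep.trivial (absoluteGaloisGroup F ⧸ galUnr F) ℤ
        ZCoeff.{u}).toTopRep // n • b = 0} →
      n ≤ Nat.card {b : continuousCohomology 2 (ContinuousRep.trivial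
        (absoluteGaloisGroup F ⧸ galUnr F) ℤ ZCoeff.{u}).toTopRep // n • b = 0} := by
    intro n hn hfinB
    obtain ⟨φ, hφ⟩ := exists_isAbsArithFrob_holds F
    have hφ1 : IsFrobPow φ 1 := IsAbsArithFrob.isFrobPow_holds hφ
    let e := H2UnrEquivQModZ hφ1
    have hn0 : (n : ℚ) ≠ 0 := Nat.cast_ne_zero.2 hn.ne'
    -- the `n`-torsion elements `k/n`
    have htor : ∀ k : Fin n, n • e.symm (QModZCoeff.mk (((k : ℕ) : ℚ) / n : ℚ)) = 0 := by
      intro k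
      rw [← map_nsmul, LinearEquiv.map_eq_zero_iff]
      apply QModZCoeff.val_injective
      rw [QModZCoeff.val_nsmul, QModZCoeff.val_mk, QModZCoeff.val_zero, ← AddCircle.coe_nsmul,
        nsmul_eq_mul, mul_div_cancel₀ _ hn0, AddCircle.coe_eq_zero_iff]
      exact ⟨k, by rw [zsmul_eq_mul, mul_one, Int.cast_natCast]⟩
    let t : Fin n → {b : continuousCohomology 2 (ContinuousRep.trivial
        (absoluteGaloisGroup F ⧸ galUnr F) ℤ ZCoeff.{u}).toTopRep // n • b = 0} := fun k =>
      ⟨e.symm (QModZCoeff.mk (((k : ℕ) : ℚ) / n : ℚ)), htor k⟩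
    have htinj : Injective t := by
      intro k k' h
      have h0 := congrArg Subtype.val h
      have h1 : QModZCoeff.mk.{u} ((((k : ℕ) : ℚ) / n : ℚ) : AddCircle (1 : ℚ)) =
          QModZCoeff.mk ((((k' : ℕ) : ℚ) / n : ℚ) : AddCircle (1 : ℚ)) :=
        e.symm.injective h0
      have h2 : ((((k : ℕ) : ℚ) / n : ℚ) : AddCircle (1 : ℚ)) = ((((k' : ℕ) : ℚ) / n : ℚ) : AddCircle (1 : ℚ)) := by
        rw [← QModZCoeff.val_mk.{u} ((((k : ℕ) : ℚ) / n : ℚ) : AddCircle (1 : ℚ)), h1, QModZCoeff.val_mk]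
      have hmem : ∀ j : Fin n, (((j : ℕ) : ℚ) / n : ℚ) ∈ Set.Ico (0 : ℚ) (0 + 1) := fun j => by
        rw [zero_add, Set.mem_Ico]
        refine ⟨div_nonneg (Nat.cast_nonneg _) (Nat.cast_nonneg _), ?_⟩
        rw [div_lt_one (Nat.cast_pos.2 hn)]
        exact_mod_cast j.2
      have h3 := (AddCircle.coe_eq_coe_iff_of_mem_Ico (hmem k) (hmem k')).1 h2
      have h4 : ((k : ℕ) : ℚ) = ((k' : ℕ) : ℚ) := by
        have := congrArg (· * (n : ℚ)) h3
        simpa only [div_mul_cancel₀ _ hn0] using this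
      exact Fin.ext (by exact_mod_cast h4)
    haveI := hfinB
    simpa only [Nat.card_eq_fintype_card, Fintype.card_fin] using Nat.card_le_card_of_injective t htinj
  refine f.injective_of_splitting_of_card_torsion_le s hfs htors (fun n hn => (hA n hn).1)
    fun n hn => ?_
  -- finiteness of `B[n]` from the injection `s : B[n] ↪ A[n]`
  haveI := (hA n hn).1
  let sn : {b : continuousCohomology 2 (ContinuousRep.trivial (absoluteGaloisGroup F ⧸ galUnr F) ℤ
      ZCoeff.{u}).toTopRep // n • b = 0} →
      {a : continuousCohomology 2 ((units F).quotientInvariants (galUnr F)).toTopRep // n • a = 0} :=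
    fun b => ⟨s b.1, by rw [← map_nsmul, b.2, map_zero]⟩
  have hsn : Injective sn := fun b b' h => Subtype.ext (by
    have h0 := congrArg Subtype.val h
    have h' : f (s b.1) = f (s b'.1) := congrArg f h0
    rwa [hfs, hfs] at h')
  have hfinB := Finite.of_injective sn hsn
  exact (hA n hn).2.trans (hB n hn hfinB)

/-- **`H²(val)` is bijective: `H²(Gal(F^nr/F), (F^nr)ˣ) ⥲ H²(Gal(F^nr/F), ℤ)` via the valuation.**
[cite: MochizukiAbsAnab2004, Prop 1.2.1 (vii) p.11] -/
theorem cohomologyMap_unrValuationHom_two_bijective :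
    Bijective (cohomologyMap (unrValuationHom F) 2) :=
  ⟨cohomologyMap_unrValuationHom_two_injective F, cohomologyMap_unrValuationHom_surjective F 2⟩

/-- **`H²(Gal(F^nr/F), U^nr) = 0`** — the unramified units are cohomologically trivial in degree `2`:
in the long exact sequence of `0 → U^nr → (F^nr)ˣ → ℤ → 0`, `H²(U^nr) → H²((F^nr)ˣ)` is injective
(`H¹(Gal(F^nr/F), ℤ) = 0`) and lands in `ker H²(val) = 0`. [cite: SerreLocalFields1979, XII §3 Lemma 3] -/
theorem subsingleton_two_unrUnitsRep :
    Subsingleton (continuousCohomology 2 (unrUnitsRep F).toTopRep) := by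
  have hS := isSES_unrUnits F
  refine ⟨fun x y => ?_⟩
  suffices h : ∀ z : continuousCohomology 2 (unrUnitsRep F).toTopRep, z = 0 by rw [h x, h y]
  intro z
  have h2 : cohomologyMap (unrUnitsIncl F) 2 z = 0 :=
    cohomologyMap_unrValuationHom_two_injective F
      ((hS.map_two_map_two z).trans (map_zero _).symm)
  obtain ⟨w, rfl⟩ := hS.exists_δ₁_eq_of_map_two_eq_zero z h2
  haveI := subsingleton_one_trivial_ZCoeff (G := absoluteGaloisGroup F ⧸ galUnr F)
  rw [Subsingleton.elim w 0, map_zero]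

/-- **The residue map of print, step N3: `H²(Gal(F^nr/F), (F^nr)ˣ) → H²(Gal(F^nr/F), ℤ) ⥲ ℚ/ℤ` is
bijective** (valuation, then «`H²(Ẑ, ℤ) = H¹(Ẑ, ℚ/ℤ) = ℚ/ℤ`», evaluation at an arithmetic Frobenius:
the trunk's `H2UnrEquivQModZ`). [cite: MochizukiAbsAnab2004, Prop 1.2.1 (vii) p.11] -/
theorem unrBrauerInvariant_bijective {φ : absoluteGaloisGroup F} (hφ : IsFrobPow φ 1) :
    Bijective fun x : continuousCohomology 2 ((units F).quotientInvariants (galUnr F)).toTopRep =>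
      H2UnrEquivQModZ hφ (cohomologyMap (unrValuationHom F) 2 x) :=
  (H2UnrEquivQModZ hφ).bijective.comp (cohomologyMap_unrValuationHom_two_bijective F)

end Literature.AnabelianGeometry.AbsoluteAnabelian

end
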